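import Summits.QuantumFields.YangMills.Theorems.BalabanUVNodesN11NoExpansionStepReductionRePinnedIntegrableCoPH

/-!
# DAG node N11 — THEOREM 1's INDUCTIVE STEP AT `rePinH θ` REDUCED TO THE EXPANSION SEQUENCES WITHOUT THE NEW-𝐄 CLAUSES: the r11 new-term clauses of the universal
# `𝐄^{(k+1)}` at the no-expansion sequences (`hlocE`, `hinvE`, `hbdE`, `hanE` of p566247) are NOT hypotheses — they are READ OFF [III] §3's law package `Sect2.LawsT … k`
# at ANY ONE expansion sequence by universality of the 𝐄-terms (the `𝐄`-spaces of the §2 tower do not read the history), and when NO sequence of length `k+1` expands the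
# witness truncated above level `k` serves every sequence

Cell `pub-ymgap`, YM-PLAN Track A (HUMAN RULING D-0062), seat `pub-ymgap-dag-n11-e` (g14; R134 fan-out row N11∕s3), route `BalabanUVNodes` rev 25 (v1.7 `CoPH` key), item K1⁷
`StabilityBAtRecordR13SepCoPH` = stmt-QuantumFields-20542 (helper lane, count-neutral).  [III] = [Balaban1988Convergent], [IV] = [Balaban1989LargeFieldI].  Sequel of this seat's
`…NoExpansionStepReductionRePinnedIntegrableCoPH` (J2, p566247).

WHY THIS FILE.  p566247 reduces Theorem 1's inductive step `ρ_k ↦ ρ_{k+1}` at the re-pinned parameter to: [III] §3's deliverable `hexp` at the EXPANSION sequences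
`Ω_{k+1}(s′) ≠ ∅` (laws `Sect2.LawsT … k` and the 𝐓-image clause of the candidate family there), the candidate family's bookkeeping (`UniversalE`, old terms kept, no new
`𝐑 ∕ 𝐁` and `E_{k+1} = E_k` at the no-expansion sequences), the old-branch rows `hA` ∕ `hmB` ∕ `hIB`, AND four clauses `hlocE ∕ hinvE ∕ hbdE ∕ hanE` — r11's new-term laws
((2.27)(i), (iii), the improved bound p. 262, (2.27)(ii)) for `𝐄^{(k+1)}` AT EVERY NO-EXPANSION SEQUENCE.  Those four are REDUNDANT: (a) `Sect2.LawsT … k` at an expansion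
sequence `s₁` CONTAINS r11's `Step.LFNewTerms … k` and `LFHypAnalytic … (k+1)` for `𝐄^{(k+1)}` of the candidate at `s₁`; the candidate is universal in 𝐄, and the §2 tower's
`𝐄`-data — `𝐃_{k+1}`, `agreeOn`, the gauge action, and the space `U^c_{k+1}(X, α_{0,k+1}, α_{1,k+1})` of (2.27)(ii) = 11b's `Sect2.spaceI`, built on the residual's `bgI`, which
def-T's `Stage13HParams.rzAt` keeps EQUAL TO THE TORUS RESIDUAL's for every history (`rzAt_bgI`, `rfl`) — do NOT read the history `s` (only the `𝐁`-space `Ũ^c` of (2.41) reads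
`{Ω_j}`): so the clauses at `s₁` ARE the clauses at every `s′` (§0 `newEClauses_of_lawsT_of_eqE`, generic frame, any two residuals with the same `bgI`); (b) if NO sequence of
length `k+1` has `Ω_{k+1} ≠ ∅`, the witness of `ρ_k` truncated above level `k` (zero new terms — this seat's `…TruncatedWitness` shape, inline) serves every sequence, and
`hexp` is void.  HENCE:
§1 ★★★ `tLaw₁₃CoPH_rePinH_of_formAtZS_of_newTerms_of_expansion_of_integrable_univE` · ★★★ `sLaw₁₃CoPH_rePinH_succ_of_formAtZS_of_newTerms_of_expansion_of_liveSel_of_integrable_univE`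
— p566247's two theorems with `hlocE ∕ hinvE ∕ hbdE ∕ hanE` GONE (the `TLaw` face asks `0 ≤ E₀`, which the `SLaw` face already carried).  THE HONEST LIST of what Theorem 1's
inductive step at `rePinH θ` still needs off the diagonal is now: `hexp` ([III] §3 at `Ω_{k+1} ≠ ∅`: laws AND clause), the candidate's bookkeeping, `hA` (dag-n11-d g10's
fluctuation truncation discharges it — successor edition), `hmB`, `hIB`.

HONEST FRAMING.  Count-neutral kernel bookkeeping (a case split, r11's structures read field by field, one `rfl` on 11b's frame); `hexp` DISPLAYED, not proved; nothing of
Bałaban asserted; the zero branches are not excluded; N11 NOT discharged; K1⁷ NOT closed; counts unmoved (typed 28∕28 · discharged 5∕27).  One finite `𝕋⁴_{L^K}` programme at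
fixed `ε = L^{−K}`; NOT ℝ⁴, NOT OS, NOT a mass gap, NOT Clay.
Sources: [III] Theorem p.245, Thm 1 p.262, §2 p.262, (2.17)–(2.18) p.257, (2.20)–(2.31) pp.258–260, (2.26)–(2.28) p.259, (2.40)–(2.42) p.261, (3.24)–(3.25) p.270, p.279;
[IV] (0.2)–(0.4) p.176, p.177 (i)–(ii); [Balaban1987RG1] (0.20) p.256.
-/

noncomputable section

open MeasureTheory
open scoped BigOperators Matrix.Norms.L2Operator

namespace Summit.QuantumFields.YangMills.Theorems.BalabanUVNodesN11NoExpansionStepReductionRePinnedUnivECoPH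

open Literature.MathematicalPhysics.QuantumFieldTheory.Balaban1983to89 T4Continuum Node00 Node00.Tk DagBinding
open Step B14.Eq227LocalizedTerms
open Literature.MathematicalPhysics.QuantumFieldTheory.Balaban1983to89.B16RLeafRecord13LiveCoPH (sLaw₁₃CoPH_succ_of_tLaw₁₃CoPH_of_liveSel_of_rstep)
open BalabanUVNodesN11RePinnedParamDefs (rePinH provisos₁₃CoPH_rePinH)
open BalabanUVNodesN11NoExpansionStepReductionRePinnedIntegrableCoPH (tLaw₁₃CoPH_rePinH_of_formAtZS_of_newTerms_of_expansion_of_integrable)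

/-! ## §0. Generic §2 frame — r11's new-term 𝐄-clauses at index `k+1` transfer between towers with the same `𝐄`-terms and the same `bgI`-residual data -/

section NewE

variable {P : Params} {𝔸 : Type*} [NormedRing 𝔸] [NormedAlgebra ℂ 𝔸] [CompleteSpace 𝔸] {V : Type*} {M : ℕ} {G : Type*} [GaugeGroup G]

/-- **THE 𝐄-SPACE OF THE §2 TOWER DOES NOT READ THE HISTORY**: 11b's `towerOfTerms … .space j X α₀ α₁ = Sect2.spaceI S Rz M j (domSites …) α₀ α₁` is built on the frame
`Sect2.frameI`, which reads the residual through `Rz.bgI` only — two residuals with the same `bgI` (e.g. def-T's `θ.rzAt p s`, `θ.rzAt p s′` of ANY two histories, whose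
`bgI` is the torus residual's by `Stage13HParams.rzAt_bgI`) and any two sequences `{Ω_j}`, `{Ω′_j}` and term values give the SAME space `U^c_j(X, α₀, α₁)` of (2.27)(ii).
[cite: Balaban1988Convergent, (2.26)–(2.28) p.259; Balaban1987RG1, (1.15) p.266 (bookkeeping)] -/
theorem towerOfTerms_space_eq_of_bgI_eq (S : Sect2.Setting 𝔸 G) {Rz Rz' : Sect2.Residual P 𝔸} (hbg : Rz'.bgI = Rz.bgI) (Ω Ω' : ℕ → Set (Site P 0))
    (t t' : Sect2.TermValues P 𝔸 V M) (j : ℕ) (X : (Sect2.domSys P M j).Dom) (α₀ α₁ : ℝ) :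
    (Sect2.towerOfTerms S Rz' M Ω' t').space j X α₀ α₁ = (Sect2.towerOfTerms S Rz M Ω t).space j X α₀ α₁ := by
  show Sect2.spaceI S Rz' M j _ α₀ α₁ = Sect2.spaceI S Rz M j _ α₀ α₁
  unfold Sect2.spaceI Sect2.frameI
  rw [hbg]

/-- **r11's NEW-TERM 𝐄-CLAUSES AT INDEX `k+1` TRANSFER** (generic §2 frame): if `t` obeys the 𝐓-image laws `Sect2.LawsT … k` on the tower `(S, Rz, M, Ω)`, then ANY term
values `t′` with the SAME 𝐄-component obey, on ANY tower `(S, Rz′, M, Ω′)` with `Rz′.bgI = Rz.bgI`, the four level-`(k+1)` 𝐄-clauses consumed by this seat's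
`…StepReductionCoPH.lawsT_towerOfTerms_of_lawsRT_of_agree_of_newE`: local dependence (2.27)(i) (`Step.LFNewTerms.localDepE`), gauge invariance (2.27)(iii) (`.gaugeInvE`), the
IMPROVED bound of p. 262 (`.improved.boundE`) and analyticity (2.27)(ii) at `k+1` (`LFHypAnalytic.analyticE`) — `𝐃_{k+1}`, `agreeOn`, the action and (by
`towerOfTerms_space_eq_of_bgI_eq`) the space are the same on both towers.  Print: the `𝐄^{(j)}(X, ·, z)` carry no sequence argument ((2.25)–(2.27)).
[cite: Balaban1988Convergent, (2.25)–(2.28) p.259, §2 p.262, §3 p.279] -/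
theorem newEClauses_of_lawsT_of_eqE (S : Sect2.Setting 𝔸 G) {Rz Rz' : Sect2.Residual P 𝔸} (hbg : Rz'.bgI = Rz.bgI) (Ω Ω' : ℕ → Set (Site P 0)) {k : ℕ}
    {t t' : Sect2.TermValues P 𝔸 V M} (hE : t'.E = t.E) (h : Sect2.LawsT (Sect2.towerOfTerms S Rz M Ω t) S.lf S.βc k) :
    (∀ X z g φ ψ, (Sect2.towerOfTerms S Rz' M Ω' t').agreeOn (k + 1) X φ ψ → t'.E (k + 1) X z g φ = t'.E (k + 1) X z g ψ) ∧
    (∀ X z g u φ, t'.E (k + 1) X z g ((Sect2.towerOfTerms S Rz' M Ω' t').act u φ) = t'.E (k + 1) X z g φ) ∧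
    (∀ X z g φ, 0 ≤ g → g ≤ S.lf.γ →
      φ ∈ (Sect2.towerOfTerms S Rz' M Ω' t').space (k + 1) X (S.lf.alpha0 (S.flow.g (k + 1))) (S.lf.alpha1 (S.flow.g (k + 1))) →
        ‖t'.E (k + 1) X z g φ‖ ≤ S.lf.E₀ * Real.exp (-((1 + 4 * S.βc) * S.lf.κ) * (Sect2.domSys P M (k + 1)).dj X)) ∧
    (∀ X z g, 0 ≤ g → g ≤ S.lf.γ →
      AnalyticOnNhd ℂ (t'.E (k + 1) X z g)
        ((Sect2.towerOfTerms S Rz' M Ω' t').space (k + 1) X (S.lf.alpha0 (S.flow.g (k + 1))) (S.lf.alpha1 (S.flow.g (k + 1))))) := by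
  obtain ⟨-, hN, hAn⟩ := h
  have hsp : ∀ (X : (Sect2.domSys P M (k + 1)).Dom) (α₀ α₁ : ℝ),
      (Sect2.towerOfTerms S Rz' M Ω' t').space (k + 1) X α₀ α₁ = (Sect2.towerOfTerms S Rz M Ω t).space (k + 1) X α₀ α₁ :=
    fun X α₀ α₁ => towerOfTerms_space_eq_of_bgI_eq S hbg Ω Ω' t t' (k + 1) X α₀ α₁
  refine ⟨fun X z g φ ψ hφψ => ?_, fun X z g u φ => ?_, fun X z g φ hg0 hgγ hφ => ?_, fun X z g hg0 hgγ => ?_⟩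
  · rw [hE]; exact hN.localDepE X z g φ ψ hφψ
  · rw [hE]; exact hN.gaugeInvE X z g u φ
  · rw [hE]; rw [hsp] at hφ; exact hN.improved.boundE (Nat.le_add_left 1 k) X z g φ hg0 hgγ hφ
  · rw [hE, hsp]; exact hAn.analyticE (k + 1) (Nat.le_add_left 1 k) le_rfl X z g hg0 hgγ

end NewE

/-! ## §1. At `rePinH θ`: `TLaw₁₃CoPH (rePinH θ) p k` and `SLaw₁₃CoPH (rePinH θ) p (k+1)` reduced to the expansion sequences, the new-𝐄 clauses NOT hypotheses -/

section Reduction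

variable {F : T4Family} {N : ℕ} [NeZero N]
variable (θ : Stage13HParams F N) (p : B12.RunParams)

/-- **★★★ `TLaw₁₃CoPH (rePinH θ) p k` REDUCED TO THE EXPANSION SEQUENCES, INTEGRABLE FORM, THE NEW-𝐄 CLAUSES NOT HYPOTHESES.**  p566247's
`tLaw₁₃CoPH_rePinH_of_formAtZS_of_newTerms_of_expansion_of_integrable` with `hlocE ∕ hinvE ∕ hbdE ∕ hanE` REMOVED (and `0 ≤ E₀` added): if SOME sequence `s₁` of length `k+1`
expands (`Ω_{k+1}(s₁) ≠ ∅`), the four clauses at every no-expansion `s′` are read off `(hexp s₁).1 : Sect2.LawsT … k` through §0 (`UniversalE tT`: `(tT s′).E = (tT s₁).E`;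
the two towers' residuals `θ.rzAt p s′`, `θ.rzAt p s₁` have the same `bgI` by `rfl`) and p566247 applies to `(tT, EkT)`; if NONE does, p566247 applies to the witness of `ρ_k`
TRUNCATED ABOVE LEVEL `k` (`(t (init s′)).E ∕ R ∕ B` at the levels `≤ k`, zero above; universal in 𝐄 because `t` is; r11's clauses for the zero values need only
`0 ≤ E₀`) and `hexp` is void.  Remaining hypotheses, honestly: `hexp` ([III] §3 proper — laws AND clause at `Ω_{k+1} ≠ ∅`), the candidate's bookkeeping `huT ∕ hold ∕ hnoR ∕
hnoB ∕ hEk`, the old action's fluctuation-locality `hA`, the old-branch rows `hmB` ∕ `hIB`.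
[cite: Balaban1988Convergent, Theorem p.245, Thm 1 p.262, §2 p.262, (2.25)–(2.28) p.259, (3.24)–(3.25) p.270, (2.18) p.257, (2.20)–(2.31) pp.258–260, (2.40)–(2.42) p.261, p.279; Balaban1989LargeFieldI, (0.2)–(0.3) p.176; Balaban1987RG1, (0.20) p.256] -/
theorem tLaw₁₃CoPH_rePinH_of_formAtZS_of_newTerms_of_expansion_of_integrable_univE (h : θ.Provisos₁₃CoPH F N) {k : ℕ} (hk : k < p.K) (hM : 1 ≤ θ.τ9.M) (hB₀ : 0 ≤ θ.s2.lf.B₀)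
    (hE₀ : 0 ≤ θ.s2.lf.E₀)
    (t : SeqOfRecord F θ.ν θ.τ9.M (gOfRecord₁₃ F N θ.toStage13Params p) p.K k → Sect2.TermValues (F.P p.K) (MatA N) (FluctV N) θ.τ9.M)
    (Ek : SeqOfRecord F θ.ν θ.τ9.M (gOfRecord₁₃ F N θ.toStage13Params p) p.K k → ℝ)
    (hS : HasSect2FormAtZS F N (FluctV N) p.K (settingOfRecord₁₃ F N θ.toStage13Params p) k (θ.rzAt p) (WtOfRecord₁₃H F N (rePinH θ) p)
      (UbgOfRecord₁₃CoP F N θ.toStage13Params p k)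
      (fun s u => Sect2.LawsRT (sect2TowerOfRecord F N (FluctV N) p.K (settingOfRecord₁₃ F N θ.toStage13Params p) (θ.rzAt p s) s u)
        (settingOfRecord₁₃ F N θ.toStage13Params p).lf k)
      (slotsOfRecord F N θ.ν θ.τ9 (EOfRecord₁₃ F N θ.toStage13Params) (wOfRecord₉ F N θ.toStage9Params) θ.ppSel p (gOfRecord₁₃ F N θ.toStage13Params p) k) t Ek)
    (tT : SeqOfRecord F θ.ν θ.τ9.M (gOfRecord₁₃ F N θ.toStage13Params p) p.K (k + 1) → Sect2.TermValues (F.P p.K) (MatA N) (FluctV N) θ.τ9.M)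
    (EkT : SeqOfRecord F θ.ν θ.τ9.M (gOfRecord₁₃ F N θ.toStage13Params p) p.K (k + 1) → ℝ) (huT : Sect2.UniversalE tT)
    (hold : ∀ s : SeqOfRecord F θ.ν θ.τ9.M (gOfRecord₁₃ F N θ.toStage13Params p) p.K (k + 1), s.Ω (k + 1) = ∅ →
      (∀ j, j ≤ k → ∀ X z g φ, (tT s).E j X z g φ = (t s.init).E j X z g φ) ∧ (∀ j, j ≤ k → ∀ X φ, (tT s).R j X φ = (t s.init).R j X φ) ∧
        (∀ j, j ≤ k → ∀ X φ a, (tT s).B j X φ a = (t s.init).B j X φ a))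
    (hnoR : ∀ s : SeqOfRecord F θ.ν θ.τ9.M (gOfRecord₁₃ F N θ.toStage13Params p) p.K (k + 1), s.Ω (k + 1) = ∅ → ∀ X φ, (tT s).R (k + 1) X φ = 0)
    (hnoB : ∀ s : SeqOfRecord F θ.ν θ.τ9.M (gOfRecord₁₃ F N θ.toStage13Params p) p.K (k + 1), s.Ω (k + 1) = ∅ → ∀ X φ a, (tT s).B (k + 1) X φ a = 0)
    (hEk : ∀ s : SeqOfRecord F θ.ν θ.τ9.M (gOfRecord₁₃ F N θ.toStage13Params p) p.K (k + 1), s.Ω (k + 1) = ∅ → EkT s = Ek s.init)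
    (hA : ∀ s : SeqOfRecord F θ.ν θ.τ9.M (gOfRecord₁₃ F N θ.toStage13Params p) p.K (k + 1), s.Ω (k + 1) = ∅ →
      ∀ (S : ℕ → Set (Site (F.P p.K) 0)) (a a' : Tk.MSFluct (F.P p.K) (FluctV N)) (Uf : GaugeField (F.P p.K) 0 (SU N)), (∀ i, i ≤ k → a i = a' i) →
      (sect2ActionDataOfRecord F N (FluctV N) p.K (settingOfRecord₁₃ F N θ.toStage13Params p) (θ.rzAt p s.init) s.init (t s.init) (S, a) (Ek s.init)).action23 k Uf =
        (sect2ActionDataOfRecord F N (FluctV N) p.K (settingOfRecord₁₃ F N θ.toStage13Params p) (θ.rzAt p s.init) s.init (t s.init) (S, a') (Ek s.init)).action23 k Uf)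
    (hmB : ∀ s : SeqOfRecord F θ.ν θ.τ9.M (gOfRecord₁₃ F N θ.toStage13Params p) p.K (k + 1), s.Ω (k + 1) = ∅ →
      ∀ S ∈ admSOfRecord F θ.ν θ.τ9.M (gOfRecord₁₃ F N θ.toStage13Params p) p.K k s.init,
      Measurable fun U₀ : GaugeField (F.P p.K) k (SU N) =>
        tkBranchOfRecord F N (FluctV N) θ.ν θ.τ9.M _ p.K (WtOfRecord₁₃H F N (rePinH θ) p s) s.init S k
          (fun ω => sect2Operand F N (FluctV N) p.K (settingOfRecord₁₃ F N θ.toStage13Params p) (θ.rzAt p s.init) s.init (t s.init) (Ek s.init)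
            (UbgOfRecord₁₃CoP F N θ.toStage13Params p k s.init) (S, fun j => (ω j).2) (fun j => (ω j).1))
          (baseCfg (V := FluctV N) k U₀))
    (hIB : ∀ s : SeqOfRecord F θ.ν θ.τ9.M (gOfRecord₁₃ F N θ.toStage13Params p) p.K (k + 1), s.Ω (k + 1) = ∅ →
      ∀ S ∈ admSOfRecord F θ.ν θ.τ9.M (gOfRecord₁₃ F N θ.toStage13Params p) p.K k s.init,
      Integrable (fun U₀ : GaugeField (F.P p.K) k (SU N) =>
        tkBranchOfRecord F N (FluctV N) θ.ν θ.τ9.M _ p.K (WtOfRecord₁₃H F N (rePinH θ) p s) s.init S k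
          (fun ω => sect2Operand F N (FluctV N) p.K (settingOfRecord₁₃ F N θ.toStage13Params p) (θ.rzAt p s.init) s.init (t s.init) (Ek s.init)
            (UbgOfRecord₁₃CoP F N θ.toStage13Params p k s.init) (S, fun j => (ω j).2) (fun j => (ω j).1))
          (baseCfg (V := FluctV N) k U₀)) (fieldMeasure (F.P p.K) k (SU N)))
    (hexp : ∀ s : SeqOfRecord F θ.ν θ.τ9.M (gOfRecord₁₃ F N θ.toStage13Params p) p.K (k + 1), s.Ω (k + 1) ≠ ∅ →
      Sect2.LawsT (sect2TowerOfRecord F N (FluctV N) p.K (settingOfRecord₁₃ F N θ.toStage13Params p) (θ.rzAt p s) s (tT s))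
          (settingOfRecord₁₃ F N θ.toStage13Params p).lf (settingOfRecord₁₃ F N θ.toStage13Params p).βc k ∧
        (slotsTOfRecord F N θ.ν θ.τ9 (EOfRecord₁₃ F N θ.toStage13Params) (wOfRecord₉ F N θ.toStage9Params) θ.ppSel p
            (gOfRecord₁₃ F N θ.toStage13Params p) (k + 1) s = 0 ∨
          ∀ᵐ V' ∂fieldMeasure (F.P p.K) (k + 1) (SU N),
            chiSeqOfRecord F N θ.ν θ.τ9.M (gOfRecord₁₃ F N θ.toStage13Params p) p.K (k + 1) s V' ≠ 0 →
              slotsTOfRecord F N θ.ν θ.τ9 (EOfRecord₁₃ F N θ.toStage13Params) (wOfRecord₉ F N θ.toStage9Params) θ.ppSel p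
                  (gOfRecord₁₃ F N θ.toStage13Params p) (k + 1) s V' =
                sect2Slot F N (FluctV N) p.K (settingOfRecord₁₃ F N θ.toStage13Params p) (θ.rzAt p s) (WtOfRecord₁₃H F N (rePinH θ) p s) s (tT s) (EkT s)
                  (UbgOfRecord₁₃CoP F N θ.toStage13Params p (k + 1) s) V')) :
    TLaw₁₃CoPH F N (rePinH θ) p k := by
  classical
  by_cases hex : ∃ s₁ : SeqOfRecord F θ.ν θ.τ9.M (gOfRecord₁₃ F N θ.toStage13Params p) p.K (k + 1), s₁.Ω (k + 1) ≠ ∅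
  · -- SOME sequence expands: r11's new-term 𝐄-clauses at every `s′` from `(hexp s₁).1` by universality (§0)
    obtain ⟨s₁, hs₁⟩ := hex
    have hC := fun s : SeqOfRecord F θ.ν θ.τ9.M (gOfRecord₁₃ F N θ.toStage13Params p) p.K (k + 1) =>
      newEClauses_of_lawsT_of_eqE (V := FluctV N) (settingOfRecord₁₃ F N θ.toStage13Params p) (Rz := θ.rzAt p s₁) (Rz' := θ.rzAt p s) rfl s₁.Ω s.Ω (huT s s₁) (hexp s₁ hs₁).1
    exact tLaw₁₃CoPH_rePinH_of_formAtZS_of_newTerms_of_expansion_of_integrable θ p h hk hM hB₀ t Ek hS tT EkT huT hold hnoR hnoB (fun s _ => (hC s).1)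
      (fun s _ => (hC s).2.1) (fun s _ => (hC s).2.2.1) (fun s _ => (hC s).2.2.2) hEk hA hmB hIB hexp
  · -- NO sequence expands: the witness of `ρ_k` truncated above level `k` serves every sequence; `hexp` is void
    push Not at hex
    have hu : Sect2.UniversalE t := hS.1
    let tT₀ : SeqOfRecord F θ.ν θ.τ9.M (gOfRecord₁₃ F N θ.toStage13Params p) p.K (k + 1) → Sect2.TermValues (F.P p.K) (MatA N) (FluctV N) θ.τ9.M := fun s =>
      ⟨fun j X z g φ => if j ≤ k then (t s.init).E j X z g φ else 0, fun j X φ => if j ≤ k then (t s.init).R j X φ else 0,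
        fun j X φ a => if j ≤ k then (t s.init).B j X φ a else 0⟩
    refine tLaw₁₃CoPH_rePinH_of_formAtZS_of_newTerms_of_expansion_of_integrable θ p h hk hM hB₀ t Ek hS tT₀ (fun s => Ek s.init) ?_ ?_ ?_ ?_ ?_ ?_ ?_ ?_
      (fun _ _ => rfl) hA hmB hIB (fun s hs => absurd (hex s) hs)
    · -- universal in 𝐄, because `t` is
      intro s s'
      funext j X z g φ
      show (if j ≤ k then (t s.init).E j X z g φ else 0) = if j ≤ k then (t s'.init).E j X z g φ else 0
      rw [hu s.init s'.init]
    · intro s _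
      exact ⟨fun j hj X z g φ => if_pos hj, fun j hj X φ => if_pos hj, fun j hj X φ a => if_pos hj⟩
    · intro s _ X φ
      exact if_neg (Nat.not_succ_le_self k)
    · intro s _ X φ a
      exact if_neg (Nat.not_succ_le_self k)
    · intro s _ X z g φ ψ _
      show (if k + 1 ≤ k then (t s.init).E (k + 1) X z g φ else 0) = if k + 1 ≤ k then (t s.init).E (k + 1) X z g ψ else 0
      rw [if_neg (Nat.not_succ_le_self k), if_neg (Nat.not_succ_le_self k)]
    · intro s _ X z g u φ
      show (if k + 1 ≤ k then (t s.init).E (k + 1) X z g _ else 0) = if k + 1 ≤ k then (t s.init).E (k + 1) X z g φ else 0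
      rw [if_neg (Nat.not_succ_le_self k), if_neg (Nat.not_succ_le_self k)]
    · intro s _ X z g φ _ _ _
      show ‖(if k + 1 ≤ k then (t s.init).E (k + 1) X z g φ else 0)‖ ≤ _
      rw [if_neg (Nat.not_succ_le_self k), norm_zero]
      exact mul_nonneg hE₀ (Real.exp_nonneg _)
    · intro s _ X z g _ _
      have hfun : (fun φ => (tT₀ s).E (k + 1) X z g φ) = fun _ => (0 : ℂ) := funext fun φ => if_neg (Nat.not_succ_le_self k)
      show AnalyticOnNhd ℂ (fun φ => (tT₀ s).E (k + 1) X z g φ) _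
      rw [hfun]
      exact analyticOnNhd_const

/-- **★★★ … HENCE `SLaw₁₃CoPH (rePinH θ) p (k+1)` ON THE LIVE-SELECTOR LINE, INTEGRABLE FORM, THE NEW-𝐄 CLAUSES NOT HYPOTHESES** — Theorem 1's complete inductive step
`ρ_k ↦ ρ_{k+1}` at the re-pinned parameter (this seat's `…LiveCoPH.sLaw₁₃CoPH_succ_of_tLaw₁₃CoPH_of_liveSel_of_rstep` over the `TLaw` face: 𝐑 of record moves only dead sequences;
node00-def-T's selector clause of `θ`, admissibility and the signs `0 ≤ κ, E₀, B₀`).  MODULO EXACTLY: `hexp` ([III] §3 at the expansion sequences — laws AND clause), the candidate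
family's bookkeeping (`huT`, `hold`, `hnoR`, `hnoB`, `hEk`), `hA`, and the old-branch rows `hmB` ∕ `hIB`; NO residual-slot hypothesis, NO new-𝐄 clause.
[cite: Balaban1988Convergent, Thm 1 p.262, Theorem p.245, §2 p.262, (2.25)–(2.28) p.259, (3.24)–(3.25) p.270, (2.17)–(2.18) p.257, p.279; Balaban1989LargeFieldI, (0.2)–(0.4) p.176, p.177 (i)–(ii)] -/
theorem sLaw₁₃CoPH_rePinH_succ_of_formAtZS_of_newTerms_of_expansion_of_liveSel_of_integrable_univE (h : θ.Provisos₁₃CoPH F N)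
    (hsel : θ.ppSel = ppSelLiveOfRecord F N θ.ν θ.τ9 (EOfRecord₁₃ F N θ.toStage13Params) (wOfRecord₉ F N θ.toStage9Params))
    (hθ : θ.Admissible F N) (hκ : 0 ≤ θ.s2.lf.κ) (hE₀ : 0 ≤ θ.s2.lf.E₀) (hB₀ : 0 ≤ θ.s2.lf.B₀) {k : ℕ} (hk : k < p.K) (hM : 1 ≤ θ.τ9.M)
    (t : SeqOfRecord F θ.ν θ.τ9.M (gOfRecord₁₃ F N θ.toStage13Params p) p.K k → Sect2.TermValues (F.P p.K) (MatA N) (FluctV N) θ.τ9.M)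
    (Ek : SeqOfRecord F θ.ν θ.τ9.M (gOfRecord₁₃ F N θ.toStage13Params p) p.K k → ℝ)
    (hS : HasSect2FormAtZS F N (FluctV N) p.K (settingOfRecord₁₃ F N θ.toStage13Params p) k (θ.rzAt p) (WtOfRecord₁₃H F N (rePinH θ) p)
      (UbgOfRecord₁₃CoP F N θ.toStage13Params p k)
      (fun s u => Sect2.LawsRT (sect2TowerOfRecord F N (FluctV N) p.K (settingOfRecord₁₃ F N θ.toStage13Params p) (θ.rzAt p s) s u)
        (settingOfRecord₁₃ F N θ.toStage13Params p).lf k)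
      (slotsOfRecord F N θ.ν θ.τ9 (EOfRecord₁₃ F N θ.toStage13Params) (wOfRecord₉ F N θ.toStage9Params) θ.ppSel p (gOfRecord₁₃ F N θ.toStage13Params p) k) t Ek)
    (tT : SeqOfRecord F θ.ν θ.τ9.M (gOfRecord₁₃ F N θ.toStage13Params p) p.K (k + 1) → Sect2.TermValues (F.P p.K) (MatA N) (FluctV N) θ.τ9.M)
    (EkT : SeqOfRecord F θ.ν θ.τ9.M (gOfRecord₁₃ F N θ.toStage13Params p) p.K (k + 1) → ℝ) (huT : Sect2.UniversalE tT)
    (hold : ∀ s : SeqOfRecord F θ.ν θ.τ9.M (gOfRecord₁₃ F N θ.toStage13Params p) p.K (k + 1), s.Ω (k + 1) = ∅ →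
      (∀ j, j ≤ k → ∀ X z g φ, (tT s).E j X z g φ = (t s.init).E j X z g φ) ∧ (∀ j, j ≤ k → ∀ X φ, (tT s).R j X φ = (t s.init).R j X φ) ∧
        (∀ j, j ≤ k → ∀ X φ a, (tT s).B j X φ a = (t s.init).B j X φ a))
    (hnoR : ∀ s : SeqOfRecord F θ.ν θ.τ9.M (gOfRecord₁₃ F N θ.toStage13Params p) p.K (k + 1), s.Ω (k + 1) = ∅ → ∀ X φ, (tT s).R (k + 1) X φ = 0)
    (hnoB : ∀ s : SeqOfRecord F θ.ν θ.τ9.M (gOfRecord₁₃ F N θ.toStage13Params p) p.K (k + 1), s.Ω (k + 1) = ∅ → ∀ X φ a, (tT s).B (k + 1) X φ a = 0)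
    (hEk : ∀ s : SeqOfRecord F θ.ν θ.τ9.M (gOfRecord₁₃ F N θ.toStage13Params p) p.K (k + 1), s.Ω (k + 1) = ∅ → EkT s = Ek s.init)
    (hA : ∀ s : SeqOfRecord F θ.ν θ.τ9.M (gOfRecord₁₃ F N θ.toStage13Params p) p.K (k + 1), s.Ω (k + 1) = ∅ →
      ∀ (S : ℕ → Set (Site (F.P p.K) 0)) (a a' : Tk.MSFluct (F.P p.K) (FluctV N)) (Uf : GaugeField (F.P p.K) 0 (SU N)), (∀ i, i ≤ k → a i = a' i) →
      (sect2ActionDataOfRecord F N (FluctV N) p.K (settingOfRecord₁₃ F N θ.toStage13Params p) (θ.rzAt p s.init) s.init (t s.init) (S, a) (Ek s.init)).action23 k Uf =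
        (sect2ActionDataOfRecord F N (FluctV N) p.K (settingOfRecord₁₃ F N θ.toStage13Params p) (θ.rzAt p s.init) s.init (t s.init) (S, a') (Ek s.init)).action23 k Uf)
    (hmB : ∀ s : SeqOfRecord F θ.ν θ.τ9.M (gOfRecord₁₃ F N θ.toStage13Params p) p.K (k + 1), s.Ω (k + 1) = ∅ →
      ∀ S ∈ admSOfRecord F θ.ν θ.τ9.M (gOfRecord₁₃ F N θ.toStage13Params p) p.K k s.init,
      Measurable fun U₀ : GaugeField (F.P p.K) k (SU N) =>
        tkBranchOfRecord F N (FluctV N) θ.ν θ.τ9.M _ p.K (WtOfRecord₁₃H F N (rePinH θ) p s) s.init S k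
          (fun ω => sect2Operand F N (FluctV N) p.K (settingOfRecord₁₃ F N θ.toStage13Params p) (θ.rzAt p s.init) s.init (t s.init) (Ek s.init)
            (UbgOfRecord₁₃CoP F N θ.toStage13Params p k s.init) (S, fun j => (ω j).2) (fun j => (ω j).1))
          (baseCfg (V := FluctV N) k U₀))
    (hIB : ∀ s : SeqOfRecord F θ.ν θ.τ9.M (gOfRecord₁₃ F N θ.toStage13Params p) p.K (k + 1), s.Ω (k + 1) = ∅ →
      ∀ S ∈ admSOfRecord F θ.ν θ.τ9.M (gOfRecord₁₃ F N θ.toStage13Params p) p.K k s.init,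
      Integrable (fun U₀ : GaugeField (F.P p.K) k (SU N) =>
        tkBranchOfRecord F N (FluctV N) θ.ν θ.τ9.M _ p.K (WtOfRecord₁₃H F N (rePinH θ) p s) s.init S k
          (fun ω => sect2Operand F N (FluctV N) p.K (settingOfRecord₁₃ F N θ.toStage13Params p) (θ.rzAt p s.init) s.init (t s.init) (Ek s.init)
            (UbgOfRecord₁₃CoP F N θ.toStage13Params p k s.init) (S, fun j => (ω j).2) (fun j => (ω j).1))
          (baseCfg (V := FluctV N) k U₀)) (fieldMeasure (F.P p.K) k (SU N)))
    (hexp : ∀ s : SeqOfRecord F θ.ν θ.τ9.M (gOfRecord₁₃ F N θ.toStage13Params p) p.K (k + 1), s.Ω (k + 1) ≠ ∅ →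
      Sect2.LawsT (sect2TowerOfRecord F N (FluctV N) p.K (settingOfRecord₁₃ F N θ.toStage13Params p) (θ.rzAt p s) s (tT s))
          (settingOfRecord₁₃ F N θ.toStage13Params p).lf (settingOfRecord₁₃ F N θ.toStage13Params p).βc k ∧
        (slotsTOfRecord F N θ.ν θ.τ9 (EOfRecord₁₃ F N θ.toStage13Params) (wOfRecord₉ F N θ.toStage9Params) θ.ppSel p
            (gOfRecord₁₃ F N θ.toStage13Params p) (k + 1) s = 0 ∨
          ∀ᵐ V' ∂fieldMeasure (F.P p.K) (k + 1) (SU N),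
            chiSeqOfRecord F N θ.ν θ.τ9.M (gOfRecord₁₃ F N θ.toStage13Params p) p.K (k + 1) s V' ≠ 0 →
              slotsTOfRecord F N θ.ν θ.τ9 (EOfRecord₁₃ F N θ.toStage13Params) (wOfRecord₉ F N θ.toStage9Params) θ.ppSel p
                  (gOfRecord₁₃ F N θ.toStage13Params p) (k + 1) s V' =
                sect2Slot F N (FluctV N) p.K (settingOfRecord₁₃ F N θ.toStage13Params p) (θ.rzAt p s) (WtOfRecord₁₃H F N (rePinH θ) p s) s (tT s) (EkT s)
                  (UbgOfRecord₁₃CoP F N θ.toStage13Params p (k + 1) s) V')) :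
    SLaw₁₃CoPH F N (rePinH θ) p (k + 1) :=
  sLaw₁₃CoPH_succ_of_tLaw₁₃CoPH_of_liveSel_of_rstep F N (rePinH θ) p (fun q j _ hj => (provisos₁₃CoPH_rePinH h).rstep q j hj) hθ hκ hE₀ hB₀ hsel k hk
    (tLaw₁₃CoPH_rePinH_of_formAtZS_of_newTerms_of_expansion_of_integrable_univE θ p h hk hM hB₀ hE₀ t Ek hS tT EkT huT hold hnoR hnoB hEk hA hmB hIB hexp)

end Reduction

end Summit.QuantumFields.YangMills.Theorems.BalabanUVNodesN11NoExpansionStepReductionRePinnedUnivECoPH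

end
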